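import Summits.CriticalPhenomena.CardyFormulaZ2.Theorems.CardyIKTransportIKMixedBoxCrossingQuenchedDefs
import Summits.CriticalPhenomena.CardyFormulaZ2.Theorems.CardyIKTransportIKLinearTransportFarRSWAllAspects

/-!
# Line `pinned-diagram-exchange` of the crux `CardyIKTransport.IKLinearTransport` (stmt-CriticalPhenomena-5076), skeleton v29:
# the two RSW residues as ASSEMBLIES over the shared quenched core `ApproxHarrisFam` — vocabulary and sorry-free compositions

Definitions-only support file (`--supports stmt-CriticalPhenomena-5076`), same device as `…WallDominationDefs.lean` (p154369) and the
sister crux's `…IKMixedBoxCrossingQuenchedDefs.lean` (p162432): every `def … : Prop` below is a statement the LINE POSITS (a registered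
stub or a derived target), never a literature fact; the compositions are kernel-checked and take the stubs as hypotheses.

THE RESHAPE (lead c9, 2026-08-17).  After v28 the line's only `sorry`s were the two RSW residues `stub_lrCrossAll` (left–right
crossings of `w × h` boxes, `n ≤ w, h ≤ k n`, for EVERY column pattern `S` and every aspect bound `k`), `stub_ringAll` (black rings in
the `n`-neighbourhood of such boxes, every `S`, every `k`) and the window transport.  Both residues are "landed box crossings + a gluing
inequality": the bottom–top clause holds for every `S` and `k` (`FarRSWAllAspects.ikFarRSW_tbCross_all`, p146877), the left–right clause
at aspect `2` is the sister crux stmt-5911 (`Split.HorizontalClause ↔ IKMixedBoxCrossing`, p143979), and the sister line's lever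
(`quenched-chain-fkg`, skeleton v7 of stmt-5911) supplies the gluing inequality in consequence form: `QuenchedChainFKG.ApproxHarrisFam`
— for every number `k` of events and `η > 0`, beyond a scale `n₀`, ANY `k` box-crossing events on boxes at least `n × n` satisfy
`μ(∩) ≥ ∏ μ − η`, uniformly in `S` (exact Harris–FKG conditionally on the colourless defect environment, plus concentration).  So:
* `LRAll` (= the registered `stub_lrCrossAll` statement) follows from `HorizontalClause` and `ApproxHarrisFam` by the LADDER: cover the
  `w × h` box (`w > 2h`) by `2h × h` boxes shifted by `h`, glue consecutive ones through bottom–top crossings of the `h × h` overlaps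
  (the sister's landed planar `glueStep`), bound the intersection by approximate Harris at scale `h ≥ n ≥ n₀`, and use the explicit floor
  `bottomRowFloor` (`(1/2)^w`, every `S`) at the finitely many scales `n < n₀` (then `w ≤ k n₀`) — `LongCrossOfHarris`;
* `RingAll` (= the registered `stub_ringAll` statement) follows from `LRAll`, the landed bottom–top clause and `ApproxHarrisFam` through the
  FRAME: black long-way crossings of the four `n`-wide strips around the box confine every white path meeting the box to the
  `n`-neighbourhood (`RingBlocking`, deterministic planar topology on the cell triangulation with ONE diagonal per face: first exit from the
  enlarged box + the sister's `GlueStep.meet`), approximate Harris for the four strips at scale `n ≥ n₀`, and at the scales `n < n₀` the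
  all-black box (finite energy `(9/25)^{wh}`, every `S`; a white path meets no black cell) — `RingOfHarris`.
After this reshape the crux's open content is exactly {stmt-5911, `ApproxHarrisFam` (ONE statement shared verbatim with 5911's live
skeleton — strategist census s2, recommendation R2), `stub_IKWindowTransport`}.

Nothing here is asserted.  `HorizontalClause`, `ApproxHarrisFam` are the sister files' definitions, imported, not restated.
-/

noncomputable section

namespace Summit.CriticalPhenomena.CardyFormulaZ2.Theorems.IKLinearTransport.PinnedDiagramExchange.QuenchedAssembly

open scoped Classical
open MeasureTheory Set
open Summit.CriticalPhenomena.CardyFormulaZ2.Theorems.IKLinearTransport.PinnedDiagramExchange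
open Summit.CriticalPhenomena.CardyFormulaZ2.Cruxes.IKMixedBoxCrossing.QuenchedChainFKG (ApproxHarrisFam)
open Summit.CriticalPhenomena.CardyFormulaZ2.Cruxes.IKMixedBoxCrossing.Split (HorizontalClause clauses_of_IKMixedBoxCrossing)
open Literature.Probability.Percolation Literature.Probability.LatticeModels

/-! ## §1 The two residues as named statements (verbatim the registered stub signatures) -/

/-- **LEFT–RIGHT CLAUSE, every pattern, every aspect bound** (verbatim the registered `stub_lrCrossAll` statement): for every `k`
there is `c > 0` such that for every `S`, `n ≥ 1`, position and `w × h` box with `n ≤ w ≤ k n`, `n ≤ h ≤ k n`, the box is crossed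
left-to-right by a black path with `ν_S`-probability `≥ c`.  A statement the line POSITS (derived target), not asserted here. -/
def LRAll : Prop :=
  ∀ k : ℕ, ∃ c : ℝ, 0 < c ∧ ∀ (S : Set ℤ) (n : ℕ) (a b : ℤ) (w h : ℕ),
    1 ≤ n → n ≤ w → w ≤ k * n → n ≤ h → h ≤ k * n → c ≤ (νmix S).real (lrCross a b w h)

/-- THE RING EVENT of the `w × h` box at `(a, b)` at distance `n`, in dual form (verbatim the set of the registered `stub_ringAll`):
every WHITE monochromatic path meeting the box `[a, a+w) × [b, b+h)` stays off `farFrom a b w h n`. -/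
def ringEvent (a b : ℤ) (w h n : ℕ) : Set Obs :=
  {x | ∀ p ∈ monoPaths x false, (∃ u ∈ p, a ≤ u 0 ∧ u 0 < a + w ∧ b ≤ u 1 ∧ u 1 < b + h) →
    ∀ v ∈ p, v ∉ farFrom a b w h n}

/-- **RING CLAUSE, every pattern, every aspect bound** (the registered `stub_ringAll` statement, through `ringEvent`; `ringAll_iff`
below is the `Iff.rfl` with the verbatim inline form): for every `k` there is `c > 0` such that for every `S`, `n ≥ 1`, position and
`w × h` box with `n ≤ w ≤ k n`, `n ≤ h ≤ k n`, the ring event has `ν_S`-probability `≥ c`.  A statement the line POSITS (derived target). -/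
def RingAll : Prop :=
  ∀ k : ℕ, ∃ c : ℝ, 0 < c ∧ ∀ (S : Set ℤ) (n : ℕ) (a b : ℤ) (w h : ℕ),
    1 ≤ n → n ≤ w → w ≤ k * n → n ≤ h → h ≤ k * n → c ≤ (νmix S).real (ringEvent a b w h n)

/-- `RingAll` is, by `Iff.rfl`, the registered `stub_ringAll` signature written inline. -/
theorem ringAll_iff : RingAll ↔
    ∀ k : ℕ, ∃ c : ℝ, 0 < c ∧ ∀ (S : Set ℤ) (n : ℕ) (a b : ℤ) (w h : ℕ),
      1 ≤ n → n ≤ w → w ≤ k * n → n ≤ h → h ≤ k * n → c ≤ (νmix S).real {x | ∀ p ∈ monoPaths x false,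
        (∃ u ∈ p, a ≤ u 0 ∧ u 0 < a + w ∧ b ≤ u 1 ∧ u 1 < b + h) → ∀ v ∈ p, v ∉ farFrom a b w h n} :=
  Iff.rfl

/-! ## §2 The frame and the deterministic blocking statement -/

/-- THE FRAME EVENT of the `w × h` box at `(a, b)` at distance `n`: black long-way crossings of the four `n`-wide strips of the
rectangular frame `[a-n, a+w+n) × [b-n, b+h+n) ∖ box` — left–right crossings of the top strip `[a-n, a+w+n) × [b+h, b+h+n)` and of the
bottom strip `[a-n, a+w+n) × [b-n, b)`, bottom–top crossings of the left strip `[a-n, a) × [b-n, b+h+n)` and of the right strip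
`[a+w, a+w+n) × [b-n, b+h+n)`. -/
def frameEvent (a b : ℤ) (w h n : ℕ) : Set Obs :=
  lrCross (a - n) (b + h) (w + 2 * n) n ∩ lrCross (a - n) (b - n) (w + 2 * n) n ∩
    (tbCross (a - n) (b - n) n (h + 2 * n) ∩ tbCross (a + w) (b - n) n (h + 2 * n))

/-- **RING BLOCKING** (deterministic planar topology, to be proved — registered stub `stub_ringBlocking`): on the frame event every
white monochromatic path of the cell triangulation (one diagonal per face, read from `x.2`) that meets the box stays off
`farFrom a b w h n`.  Route: a white path from a box cell to a far cell leaves the enlarged box `[a-n, a+w+n) × [b-n, b+h+n)` a first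
time; according to the side of the exit, its piece after the last visit to the box rows/columns is a white short-way crossing of the
corresponding strip, which shares a cell with the black long-way crossing of that strip (`GlueStep.meet`) — black ≠ white.
A statement the line POSITS (registered stub), not asserted here. -/
def RingBlocking : Prop :=
  ∀ (x : Obs) (a b : ℤ) (w h n : ℕ), 1 ≤ n → x ∈ frameEvent a b w h n → x ∈ ringEvent a b w h n

/-! ## §3 The two assemblies over the shared core -/

/-- **LONG CROSSINGS FROM THE HORIZONTAL CLAUSE BY APPROXIMATE HARRIS** (to be proved — registered stub `stub_longCrossOfHarris`):
`HorizontalClause → ApproxHarrisFam → LRAll`.  Route: for `w ≤ 2h` antitonicity in the width (`stub_monotone`); for `w > 2h` the ladder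
of `2h × h` boxes at shifts `j h` glued by bottom–top crossings of the `h × h` overlaps (`glueStep`, `verticalClause_aspect 1`) and ONE
application of `ApproxHarrisFam` (at most `2k+1` events, all boxes `≥ h × h`, `h ≥ n ≥ n₀`); for `n < n₀` the floor `bottomRowFloor`
(`w ≤ k n₀`).  A statement the line POSITS (registered stub), not asserted here. -/
def LongCrossOfHarris : Prop := HorizontalClause → ApproxHarrisFam → LRAll

/-- **RINGS FROM CROSSINGS BY APPROXIMATE HARRIS** (to be proved — registered stub `stub_ringOfHarris`):
`RingBlocking → LRAll → ApproxHarrisFam → RingAll`.  Route: for `n ≥ n₀` the frame (`ApproxHarrisFam` with four events on boxes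
`≥ n × n`: the two horizontal strips by `LRAll (k+2)`, the two vertical strips by `FarRSWAllAspects.ikFarRSW_tbCross_all (k+2)`) and
`RingBlocking`; for `n < n₀` the all-black box (`stub_finiteEnergy`, `(9/25)^{w h}` with `w, h ≤ k n₀`), on which no white path meets the
box.  A statement the line POSITS (registered stub), not asserted here. -/
def RingOfHarris : Prop := RingBlocking → LRAll → ApproxHarrisFam → RingAll

/-! ## §4 Registered stubs (name-keyed aliases) and the sorry-free compositions -/

namespace Registered

/-- Alias keyed by the registered stub name (provable: the ladder). -/
abbrev stub_longCrossOfHarris : Prop := LongCrossOfHarris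
/-- Alias keyed by the registered stub name (provable: planar blocking). -/
abbrev stub_ringBlocking : Prop := RingBlocking
/-- Alias keyed by the registered stub name (provable: the frame assembly). -/
abbrev stub_ringOfHarris : Prop := RingOfHarris

end Registered

/-- The horizontal clause from the sister crux's route decl (`IKMixedBoxCrossing`, stmt-5911), through the landed typed split. -/
theorem horizontalClause_of_mixedRSW
    (h : Summit.CriticalPhenomena.CardyFormulaZ2.Theses.CardyIKTransport.IKMixedBoxCrossing) : HorizontalClause :=
  (clauses_of_IKMixedBoxCrossing h).2

/-- **COMPOSITION 1 (kernel-checked, sorry-free):** the left–right clause for every pattern and aspect from the sister crux, the shared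
core and the ladder stub. -/
theorem lrAll_of (hM : Summit.CriticalPhenomena.CardyFormulaZ2.Theses.CardyIKTransport.IKMixedBoxCrossing)
    (hF : ApproxHarrisFam) (hC : LongCrossOfHarris) : LRAll :=
  hC (horizontalClause_of_mixedRSW hM) hF

/-- **COMPOSITION 2 (kernel-checked, sorry-free):** the ring clause for every pattern and aspect from the sister crux, the shared core
and the three provable stubs. -/
theorem ringAll_of (hM : Summit.CriticalPhenomena.CardyFormulaZ2.Theses.CardyIKTransport.IKMixedBoxCrossing)
    (hF : ApproxHarrisFam) (hC : LongCrossOfHarris) (hB : RingBlocking) (hD : RingOfHarris) : RingAll :=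
  hD hB (lrAll_of hM hF hC) hF

/-- The same two compositions keyed by the registered names. -/
theorem residues_of_registered
    (hM : Summit.CriticalPhenomena.CardyFormulaZ2.Theses.CardyIKTransport.IKMixedBoxCrossing) (hF : ApproxHarrisFam)
    (hC : Registered.stub_longCrossOfHarris) (hB : Registered.stub_ringBlocking) (hD : Registered.stub_ringOfHarris) :
    LRAll ∧ RingAll :=
  ⟨lrAll_of hM hF hC, ringAll_of hM hF hC hB hD⟩

/-- **THE v29 COMPOSITION, registered form** (sub-goal `quenchedAssembly_compositions` of stmt-CriticalPhenomena-5076): the sister crux, the shared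
core and the three provable stubs give BOTH RSW residues of the line. -/
theorem quenchedAssembly_compositions : Summit.CriticalPhenomena.CardyFormulaZ2.Theses.CardyIKTransport.IKMixedBoxCrossing → ApproxHarrisFam → LongCrossOfHarris → RingBlocking → RingOfHarris → LRAll ∧ RingAll :=
  fun hM hF hC hB hD => ⟨lrAll_of hM hF hC, ringAll_of hM hF hC hB hD⟩

end Summit.CriticalPhenomena.CardyFormulaZ2.Theorems.IKLinearTransport.PinnedDiagramExchange.QuenchedAssembly

end
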